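import Summits.QuantumAdvantage.QuantumAdvantage.Theses.LinnikCubicClassGroups
import Literature.Computability.Complexity.CodeFPLog
import Literature.Computability.Complexity.NatCbrtFP

/-!
# Crux `LinnikCubicClassGroups.PureCubicClassGroupFBQP` (stmt-QuantumAdvantage-11544) — stub `stub_cubicLogFP`

Line `arakelov-giant-step-cycle`, stub `stub_cubicLogFP` (G3): CERTIFIED LOGARITHMS OF ELEMENTS OF A PURE
CUBIC FIELD ON CODES. For `a, b ≥ 1` put `θ₁ = (ab²)^{1/3}`, `θ₂ = (a²b)^{1/3}` (real cube roots); an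
element code `e = (x, y, z, den)` (`den ≥ 1`) names the real number `V(e) = (x + y θ₁ + z θ₂)/den`
(the real embedding of `(x + yθ + zθ²/b)/den ∈ ℚ(θ)`, `θ³ = ab²`). We give a `CodeFP` program
`logE ((a, b), (e, 1ᵖ)) ∈ ℤ` with `|logE − 2ᵖ log V(e)| ≤ 1` whenever `V(e) ≥ 2⁻ᵖ`.

ALGORITHM. With `S = |y| + |z|` and the working exponent `j = 2p + |S|₂ + 3` (unary; `|S|₂ = Nat.size S`):
`tᵢ = ⌊2ʲ θᵢ⌋ = Nat.nthRoot 3 (Mᵢ 8ʲ)` (`M₁ = ab²`, `M₂ = a²b`; the tree's `natCbrtScaled`),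
`num = x 2ʲ + y t₁ + z t₂ ∈ ℤ` (so `|num − 2ʲ den V| ≤ S`), `L = lnDyadicZ num⁺ (den 2ʲ) (p + 2)`
(the tree's certified logarithm of a rational, `|log (num/(den 2ʲ)) − L/2^{p+2}| ≤ 2^{−p−2}`), and
`logE = ⌊(L + 2)/4⌋`.

ERROR. `2ʲ den V ≥ 2^{j−p} = 2^{p+3} 2^{|S|₂} > 2^{p+3} S`, so `r = num/(2ʲ den V)` has
`|r − 1| ≤ 2^{−p−3}` (in particular `num ≥ 1`) and `|log r| ≤ 2|r − 1| ≤ 2^{−p−2}`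
(`log r ≤ r − 1`, `1 − 1/r ≤ log r`); `log (num/(den 2ʲ)) = log r + log V`. Total, in units of `2⁻ᵖ`:
rounding `1/2` + `lnDyadicZ` `1/4` + cube roots `1/4` `= 1`.
-/

namespace Summit.QuantumAdvantage.QuantumAdvantage.Theorems.LinnikCubicClassGroups

open Literature.Computability.Complexity (CodeFP)
open Literature.Computability.Complexity.CodeFP (pairE natE intE bitE unE rawE fst snd const natAdd natMul
  natPow intAdd intMul intOfNat intToNat intNatAbs intEDiv unAdd unSucc natCbrtScaled
  abs_rpow_third_sub_nthRoot_div_le)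
open Literature.Computability.Complexity.LogFP (lnDyadicZ abs_log_div_sub_lnDyadicZ_le codeFP_lnDyadicZ
  codeFP_unSize)

/-! ### Two elementary estimates -/

/-- For `r > 0` with `|r − 1| ≤ 1/2`: `|log r| ≤ 2 |r − 1|` (`log r ≤ r − 1` and `1 − r⁻¹ ≤ log r`). -/
theorem abs_log_le_two_mul_abs_sub_one {r : ℝ} (hr : 0 < r) (h : |r - 1| ≤ 1 / 2) :
    |Real.log r| ≤ 2 * |r - 1| := by
  have h1 : Real.log r ≤ r - 1 := Real.log_le_sub_one_of_pos hr
  have h2 : 1 - r⁻¹ ≤ Real.log r := Real.one_sub_inv_le_log_of_pos hr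
  rcases le_or_gt 1 r with hr1 | hr1
  · rw [abs_of_nonneg (Real.log_nonneg hr1), abs_of_nonneg (by linarith)]
    linarith
  · have hlt : Real.log r < 0 := Real.log_neg hr hr1
    have hr2 : 1 / 2 ≤ r := by rw [abs_le] at h; linarith
    rw [abs_of_neg hlt, abs_of_neg (by linarith)]
    have h3 : r⁻¹ - 1 ≤ 2 * (1 - r) := by
      rw [inv_eq_one_div, div_sub_one hr.ne', div_le_iff₀ hr]
      nlinarith
    linarith

/-- Rounding division by `4`: `|⌊(L + 2)/4⌋ − L/4| ≤ 1/2`. -/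
theorem abs_ediv_four_sub_le (L : ℤ) : |(((L + 2) / 4 : ℤ) : ℝ) - (L : ℝ) / 4| ≤ 1 / 2 := by
  have hq : 4 * ((L + 2) / 4) = L + 2 - (L + 2) % 4 := by omega
  have hm0 : 0 ≤ (L + 2) % 4 := by omega
  have hm3 : (L + 2) % 4 ≤ 3 := by omega
  have hqR : (4 : ℝ) * (((L + 2) / 4 : ℤ) : ℝ) = (L : ℝ) + 2 - (((L + 2) % 4 : ℤ) : ℝ) := by
    exact_mod_cast hq
  have hm0R : (0 : ℝ) ≤ (((L + 2) % 4 : ℤ) : ℝ) := by exact_mod_cast hm0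
  have hm3R : (((L + 2) % 4 : ℤ) : ℝ) ≤ 3 := by exact_mod_cast hm3
  rw [abs_le]
  constructor <;> linarith

/-! ### The error analysis -/

/-- **Accuracy of the program's value.** For `den ≥ 1`, `j ≥ 2 prec + |(|y| + |z|)|₂ + 3` and
`V = (x + y (ab²)^{1/3} + z (a²b)^{1/3})/den ≥ 2^{−prec}`, the integer
`⌊(lnDyadicZ num⁺ (den 2ʲ) (prec + 2) + 2)/4⌋`, `num = x 2ʲ + y ⌊2ʲ (ab²)^{1/3}⌋ + z ⌊2ʲ (a²b)^{1/3}⌋`,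
is within `1` of `2^{prec} log V`. -/
theorem cubicLog_spec {a b den : ℕ} (hden : 1 ≤ den) (x y z : ℤ) {prec j : ℕ}
    (hj : 2 * prec + Nat.size (y.natAbs + z.natAbs) + 3 ≤ j)
    (hV : (1 : ℝ) / 2 ^ prec ≤ ((x : ℝ) + (y : ℝ) * (((a * b ^ 2 : ℕ) : ℝ) ^ ((1 : ℝ) / 3)) +
        (z : ℝ) * (((a ^ 2 * b : ℕ) : ℝ) ^ ((1 : ℝ) / 3))) / (den : ℝ)) :
    |((((lnDyadicZ (x * ((2 ^ j : ℕ) : ℤ) + y * (Nat.nthRoot 3 (a * b ^ 2 * 8 ^ j) : ℤ) +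
          z * (Nat.nthRoot 3 (a ^ 2 * b * 8 ^ j) : ℤ)).toNat (den * 2 ^ j) (prec + 2) + 2) / 4 : ℤ)) : ℝ) -
      2 ^ prec * Real.log (((x : ℝ) + (y : ℝ) * (((a * b ^ 2 : ℕ) : ℝ) ^ ((1 : ℝ) / 3)) +
        (z : ℝ) * (((a ^ 2 * b : ℕ) : ℝ) ^ ((1 : ℝ) / 3))) / (den : ℝ))| ≤ 1 := by
  set θ₁ : ℝ := ((a * b ^ 2 : ℕ) : ℝ) ^ ((1 : ℝ) / 3) with hθ₁
  set θ₂ : ℝ := ((a ^ 2 * b : ℕ) : ℝ) ^ ((1 : ℝ) / 3) with hθ₂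
  set W : ℝ := (x : ℝ) + (y : ℝ) * θ₁ + (z : ℝ) * θ₂ with hW
  set t₁ : ℕ := Nat.nthRoot 3 (a * b ^ 2 * 8 ^ j) with ht₁
  set t₂ : ℕ := Nat.nthRoot 3 (a ^ 2 * b * 8 ^ j) with ht₂
  set num : ℤ := x * ((2 ^ j : ℕ) : ℤ) + y * (t₁ : ℤ) + z * (t₂ : ℤ) with hnum
  set S : ℕ := y.natAbs + z.natAbs with hS
  set L : ℤ := lnDyadicZ num.toNat (den * 2 ^ j) (prec + 2) with hL
  have h2p : (0 : ℝ) < 2 ^ prec := by positivity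
  have h2j : (0 : ℝ) < 2 ^ j := by positivity
  have hdenR : (0 : ℝ) < den := by exact_mod_cast hden
  -- `W ≥ 2^{-prec} > 0`
  have hWge : 1 / 2 ^ prec ≤ W := by
    have h1 : 1 / 2 ^ prec ≤ W / den := hV
    rw [le_div_iff₀ hdenR] at h1
    have hd1 : (1 : ℝ) ≤ den := by exact_mod_cast hden
    have h0 : (0 : ℝ) < 1 / 2 ^ prec := by positivity
    nlinarith
  have hWpos : 0 < W := lt_of_lt_of_le (by positivity) hWge
  -- the scaled cube roots are within `1`
  have hc : ∀ n : ℕ, |2 ^ j * ((n : ℝ) ^ ((1 : ℝ) / 3)) - (Nat.nthRoot 3 (n * 8 ^ j) : ℝ)| ≤ 1 := by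
    intro n
    have h := abs_rpow_third_sub_nthRoot_div_le n j
    have e : 2 ^ j * ((n : ℝ) ^ ((1 : ℝ) / 3)) - (Nat.nthRoot 3 (n * 8 ^ j) : ℝ) =
        2 ^ j * (((n : ℝ) ^ ((1 : ℝ) / 3)) - (Nat.nthRoot 3 (n * 8 ^ j) : ℝ) / 2 ^ j) := by
      field_simp
    rw [e, abs_mul, abs_of_pos h2j]
    calc 2 ^ j * |(n : ℝ) ^ ((1 : ℝ) / 3) - (Nat.nthRoot 3 (n * 8 ^ j) : ℝ) / 2 ^ j|
        ≤ 2 ^ j * (1 / 2 ^ j) := mul_le_mul_of_nonneg_left h h2j.le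
      _ = 1 := by field_simp
  have hc₁ : |2 ^ j * θ₁ - (t₁ : ℝ)| ≤ 1 := hc (a * b ^ 2)
  have hc₂ : |2 ^ j * θ₂ - (t₂ : ℝ)| ≤ 1 := hc (a ^ 2 * b)
  -- `|num - 2^j W| ≤ S`
  have hSR : (S : ℝ) = |(y : ℝ)| + |(z : ℝ)| := by
    rw [hS]; push_cast; rw [Nat.cast_natAbs, Nat.cast_natAbs, Int.cast_abs, Int.cast_abs]
  have hnumR : (num : ℝ) - 2 ^ j * W =
      -((y : ℝ) * (2 ^ j * θ₁ - (t₁ : ℝ)) + (z : ℝ) * (2 ^ j * θ₂ - (t₂ : ℝ))) := by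
    rw [hnum, hW]; push_cast; ring
  have hd : |(num : ℝ) - 2 ^ j * W| ≤ S := by
    rw [hnumR, abs_neg, hSR]
    calc |(y : ℝ) * (2 ^ j * θ₁ - (t₁ : ℝ)) + (z : ℝ) * (2 ^ j * θ₂ - (t₂ : ℝ))|
        ≤ |(y : ℝ) * (2 ^ j * θ₁ - (t₁ : ℝ))| + |(z : ℝ) * (2 ^ j * θ₂ - (t₂ : ℝ))| := abs_add_le _ _
      _ ≤ |(y : ℝ)| * 1 + |(z : ℝ)| * 1 := by
          rw [abs_mul, abs_mul]
          exact add_le_add (mul_le_mul_of_nonneg_left hc₁ (abs_nonneg _))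
            (mul_le_mul_of_nonneg_left hc₂ (abs_nonneg _))
      _ = |(y : ℝ)| + |(z : ℝ)| := by ring
  -- the choice of `j`: `S 2^{prec+3} < 2^j W`
  have hkey : (S : ℝ) * 2 ^ (prec + 3) < 2 ^ j * W := by
    have hSlt : (S : ℝ) < 2 ^ Nat.size S := by exact_mod_cast Nat.lt_size_self S
    have hpowj : (2 : ℝ) ^ (2 * prec + Nat.size S + 3) ≤ 2 ^ j := pow_le_pow_right₀ (by norm_num) hj
    have e : (2 : ℝ) ^ (2 * prec + Nat.size S + 3) = 2 ^ prec * (2 ^ Nat.size S * 2 ^ (prec + 3)) := by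
      rw [← pow_add, ← pow_add]; congr 1; ring
    calc (S : ℝ) * 2 ^ (prec + 3) < 2 ^ Nat.size S * 2 ^ (prec + 3) := by gcongr
      _ = 2 ^ (2 * prec + Nat.size S + 3) * (1 / 2 ^ prec) := by rw [e]; field_simp
      _ ≤ 2 ^ j * W := mul_le_mul hpowj hWge (by positivity) (by positivity)
  have hS0 : (0 : ℝ) ≤ S := by positivity
  have hSle : (S : ℝ) ≤ S * 2 ^ (prec + 3) := le_mul_of_one_le_right hS0 (one_le_pow₀ (by norm_num))
  -- `num ≥ 1`
  have hnum_pos : (0 : ℝ) < num := by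
    have := (abs_le.1 hd).1
    linarith
  have hnum0 : 0 < num := Int.cast_pos.1 hnum_pos
  have htoNat : ((num.toNat : ℕ) : ℝ) = (num : ℝ) := by
    rw [← Int.cast_natCast, Int.toNat_of_nonneg hnum0.le]
  have hN1 : 1 ≤ num.toNat := by omega
  have hD1 : 1 ≤ den * 2 ^ j := Nat.one_le_iff_ne_zero.2 (by positivity)
  -- the certified logarithm of the rational `num/(den 2^j)`
  have hLspec := abs_log_div_sub_lnDyadicZ_le hN1 hD1 (prec + 2)
  rw [← hL] at hLspec
  -- `num/(den 2^j) = r · (W/den)`, `r = num/(2^j W)` close to `1`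
  have hA : (0 : ℝ) < 2 ^ j * W := mul_pos h2j hWpos
  set r : ℝ := (num : ℝ) / (2 ^ j * W) with hr
  have hrpos : 0 < r := div_pos hnum_pos hA
  have hr1 : |r - 1| ≤ 1 / 2 ^ (prec + 3) := by
    rw [hr, div_sub_one hA.ne', abs_div, abs_of_pos hA, div_le_div_iff₀ hA (by positivity), one_mul]
    calc |(num : ℝ) - 2 ^ j * W| * 2 ^ (prec + 3) ≤ S * 2 ^ (prec + 3) := by gcongr
      _ ≤ 2 ^ j * W := hkey.le
  have hr1' : |r - 1| ≤ 1 / 2 := by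
    refine hr1.trans (one_div_le_one_div_of_le (by norm_num) ?_)
    calc (2 : ℝ) = 2 ^ 1 := (pow_one _).symm
      _ ≤ 2 ^ (prec + 3) := pow_le_pow_right₀ (by norm_num) (by omega)
  have hlogr : |Real.log r| ≤ 2 * |r - 1| := abs_log_le_two_mul_abs_sub_one hrpos hr1'
  have hND : ((num.toNat : ℕ) : ℝ) / ((den * 2 ^ j : ℕ) : ℝ) = r * (W / den) := by
    rw [htoNat, hr]; push_cast; field_simp
  have hsplit : Real.log (((num.toNat : ℕ) : ℝ) / ((den * 2 ^ j : ℕ) : ℝ)) = Real.log r + Real.log (W / den) := by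
    rw [hND, Real.log_mul hrpos.ne' (div_pos hWpos hdenR).ne']
  -- the three error terms
  have hround := abs_ediv_four_sub_le L
  have hLq : |(L : ℝ) / 4 - 2 ^ prec * Real.log (((num.toNat : ℕ) : ℝ) / ((den * 2 ^ j : ℕ) : ℝ))| ≤ 1 / 4 := by
    have e : (L : ℝ) / 4 - 2 ^ prec * Real.log (((num.toNat : ℕ) : ℝ) / ((den * 2 ^ j : ℕ) : ℝ)) =
        -(2 ^ prec * (Real.log (((num.toNat : ℕ) : ℝ) / ((den * 2 ^ j : ℕ) : ℝ)) - (L : ℝ) / 2 ^ (prec + 2))) := by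
      rw [pow_add]; field_simp; ring
    rw [e, abs_neg, abs_mul, abs_of_pos h2p]
    calc 2 ^ prec * |Real.log (((num.toNat : ℕ) : ℝ) / ((den * 2 ^ j : ℕ) : ℝ)) - (L : ℝ) / 2 ^ (prec + 2)|
        ≤ 2 ^ prec * (1 / 2 ^ (prec + 2)) := mul_le_mul_of_nonneg_left hLspec h2p.le
      _ = 1 / 4 := by rw [pow_add]; field_simp; norm_num
  have hrq : 2 ^ prec * |Real.log r| ≤ 1 / 4 := by
    calc 2 ^ prec * |Real.log r| ≤ 2 ^ prec * (2 * (1 / 2 ^ (prec + 3))) := by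
          refine mul_le_mul_of_nonneg_left (hlogr.trans ?_) h2p.le
          linarith
      _ = 1 / 4 := by rw [pow_add]; field_simp; norm_num
  have hlogV : Real.log (W / den) =
      Real.log (((num.toNat : ℕ) : ℝ) / ((den * 2 ^ j : ℕ) : ℝ)) - Real.log r := by linarith [hsplit]
  rw [hlogV]
  calc |((((L + 2) / 4 : ℤ)) : ℝ) - 2 ^ prec * (Real.log (((num.toNat : ℕ) : ℝ) / ((den * 2 ^ j : ℕ) : ℝ)) - Real.log r)|
      = |((((L + 2) / 4 : ℤ) : ℝ) - (L : ℝ) / 4) +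
          ((L : ℝ) / 4 - 2 ^ prec * Real.log (((num.toNat : ℕ) : ℝ) / ((den * 2 ^ j : ℕ) : ℝ))) +
          2 ^ prec * Real.log r| := by ring_nf
    _ ≤ |(((L + 2) / 4 : ℤ) : ℝ) - (L : ℝ) / 4| +
          |(L : ℝ) / 4 - 2 ^ prec * Real.log (((num.toNat : ℕ) : ℝ) / ((den * 2 ^ j : ℕ) : ℝ))| +
          |2 ^ prec * Real.log r| := abs_add_three _ _ _
    _ ≤ 1 / 2 + 1 / 4 + 1 / 4 := by
        rw [abs_mul, abs_of_pos h2p]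
        exact add_le_add (add_le_add hround hLq) hrq
    _ = 1 := by norm_num

/-! ### The program -/

/-- The working exponent `j(p) = 2 prec + |(|y| + |z|)|₂ + 3` is computed on codes, in unary. -/
theorem codeFP_cubicLogExp :
    CodeFP (pairE (pairE natE natE) (pairE (pairE intE (pairE intE (pairE intE natE))) unE)) unE
      (fun p : (ℕ × ℕ) × ((ℤ × ℤ × ℤ × ℕ) × ℕ) =>
        2 * p.2.2 + Nat.size (p.2.1.2.1.natAbs + p.2.1.2.2.1.natAbs) + 3) := by
  let I := pairE (pairE natE natE) (pairE (pairE intE (pairE intE (pairE intE natE))) unE)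
  have hy : CodeFP I intE (fun p => p.2.1.2.1) := (snd _ _).fst'.snd'.fst'
  have hz : CodeFP I intE (fun p => p.2.1.2.2.1) := (snd _ _).fst'.snd'.snd'.fst'
  have hprec : CodeFP I unE (fun p => p.2.2) := (snd _ _).snd'
  have hS : CodeFP I natE (fun p => p.2.1.2.1.natAbs + p.2.1.2.2.1.natAbs) :=
    (natAdd.comp ((intNatAbs.comp hy).pair (intNatAbs.comp hz)) :)
  have hsz : CodeFP I unE (fun p => Nat.size (p.2.1.2.1.natAbs + p.2.1.2.2.1.natAbs)) :=
    (codeFP_unSize.comp hS :)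
  have h3 : CodeFP I unE (fun _ => (3 : ℕ)) := const _ 3
  exact (unAdd.comp ((unAdd.comp ((unAdd.comp (hprec.pair hprec)).pair hsz)).pair h3)).congr fun p => by
    simp only; ring

/-- The program with an arbitrary code-computable working exponent `J` (unary):
`p ↦ ⌊(lnDyadicZ num⁺ (den 2ᴶ) (prec + 2) + 2)/4⌋`, `num = x 2ᴶ + y ⌊∛(ab² 8ᴶ)⌋ + z ⌊∛(a²b 8ᴶ)⌋`. -/
theorem codeFP_cubicLogCore {J : (ℕ × ℕ) × ((ℤ × ℤ × ℤ × ℕ) × ℕ) → ℕ}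
    (hJ : CodeFP (pairE (pairE natE natE) (pairE (pairE intE (pairE intE (pairE intE natE))) unE)) unE J) :
    CodeFP (pairE (pairE natE natE) (pairE (pairE intE (pairE intE (pairE intE natE))) unE)) intE
      (fun p : (ℕ × ℕ) × ((ℤ × ℤ × ℤ × ℕ) × ℕ) =>
        (lnDyadicZ (p.2.1.1 * ((2 ^ J p : ℕ) : ℤ) + p.2.1.2.1 * (Nat.nthRoot 3 (p.1.1 * p.1.2 ^ 2 * 8 ^ J p) : ℤ) +
            p.2.1.2.2.1 * (Nat.nthRoot 3 (p.1.1 ^ 2 * p.1.2 * 8 ^ J p) : ℤ)).toNat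
          (p.2.1.2.2.2 * 2 ^ J p) (p.2.2 + 2) + 2) / 4) := by
  let I := pairE (pairE natE natE) (pairE (pairE intE (pairE intE (pairE intE natE))) unE)
  have ha : CodeFP I natE (fun p => p.1.1) := (fst _ _).fst'
  have hb : CodeFP I natE (fun p => p.1.2) := (fst _ _).snd'
  have hx : CodeFP I intE (fun p => p.2.1.1) := (snd _ _).fst'.fst'
  have hy : CodeFP I intE (fun p => p.2.1.2.1) := (snd _ _).fst'.snd'.fst'
  have hz : CodeFP I intE (fun p => p.2.1.2.2.1) := (snd _ _).fst'.snd'.snd'.fst'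
  have hden : CodeFP I natE (fun p => p.2.1.2.2.2) := (snd _ _).fst'.snd'.snd'.snd'
  have hprec : CodeFP I unE (fun p => p.2.2) := (snd _ _).snd'
  have hJ' : CodeFP I unE J := hJ
  have h2 : CodeFP I natE (fun _ => (2 : ℕ)) := const _ 2
  have h2J : CodeFP I natE (fun p => 2 ^ J p) := (natPow.comp (h2.pair hJ') :)
  have hab2 : CodeFP I natE (fun p => p.1.1 * p.1.2 ^ 2) :=
    (natMul.comp (ha.pair (natMul.comp (hb.pair hb)))).congr fun p => by simp only; ring
  have ha2b : CodeFP I natE (fun p => p.1.1 ^ 2 * p.1.2) :=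
    (natMul.comp ((natMul.comp (ha.pair ha)).pair hb)).congr fun p => by simp only; ring
  have ht₁ : CodeFP I natE (fun p => Nat.nthRoot 3 (p.1.1 * p.1.2 ^ 2 * 8 ^ J p)) :=
    (natCbrtScaled.comp (hab2.pair hJ') :)
  have ht₂ : CodeFP I natE (fun p => Nat.nthRoot 3 (p.1.1 ^ 2 * p.1.2 * 8 ^ J p)) :=
    (natCbrtScaled.comp (ha2b.pair hJ') :)
  have hnum : CodeFP I intE (fun p => p.2.1.1 * ((2 ^ J p : ℕ) : ℤ) +
      p.2.1.2.1 * (Nat.nthRoot 3 (p.1.1 * p.1.2 ^ 2 * 8 ^ J p) : ℤ) +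
      p.2.1.2.2.1 * (Nat.nthRoot 3 (p.1.1 ^ 2 * p.1.2 * 8 ^ J p) : ℤ)) :=
    (intAdd.comp ((intAdd.comp ((intMul.comp (hx.pair (intOfNat.comp h2J))).pair
      (intMul.comp (hy.pair (intOfNat.comp ht₁))))).pair (intMul.comp (hz.pair (intOfNat.comp ht₂)))) :)
  have hN : CodeFP I natE (fun p => (p.2.1.1 * ((2 ^ J p : ℕ) : ℤ) +
      p.2.1.2.1 * (Nat.nthRoot 3 (p.1.1 * p.1.2 ^ 2 * 8 ^ J p) : ℤ) +
      p.2.1.2.2.1 * (Nat.nthRoot 3 (p.1.1 ^ 2 * p.1.2 * 8 ^ J p) : ℤ)).toNat) := (intToNat.comp hnum :)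
  have hD : CodeFP I natE (fun p => p.2.1.2.2.2 * 2 ^ J p) := (natMul.comp (hden.pair h2J) :)
  have hp2 : CodeFP I unE (fun p => p.2.2 + 2) := (unSucc.comp (unSucc.comp hprec)).congr fun _ => rfl
  have hL : CodeFP I intE (fun p => lnDyadicZ (p.2.1.1 * ((2 ^ J p : ℕ) : ℤ) +
      p.2.1.2.1 * (Nat.nthRoot 3 (p.1.1 * p.1.2 ^ 2 * 8 ^ J p) : ℤ) +
      p.2.1.2.2.1 * (Nat.nthRoot 3 (p.1.1 ^ 2 * p.1.2 * 8 ^ J p) : ℤ)).toNat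
        (p.2.1.2.2.2 * 2 ^ J p) (p.2.2 + 2)) := (codeFP_lnDyadicZ.comp (hN.pair (hD.pair hp2)) :)
  have hc2 : CodeFP I intE (fun _ => (2 : ℤ)) := const _ 2
  have hc4 : CodeFP I intE (fun _ => (4 : ℤ)) := const _ 4
  exact (intEDiv.comp ((intAdd.comp (hL.pair hc2)).pair hc4)).congr fun _ => rfl

/-! ### The stub -/

/-- **G3 `stub_cubicLogFP`.** A polynomial-time program on codes returning, for `a, b ≥ 1`, an element
code `e = (x, y, z, den)` (`den ≥ 1`) and a unary precision `prec` such that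
`V = (x + y (ab²)^{1/3} + z (a²b)^{1/3})/den ≥ 2^{−prec}`, an integer within `1` of `2^{prec} log V`. -/
theorem stub_cubicLogFP :
    ∃ logE : (ℕ × ℕ) × ((ℤ × ℤ × ℤ × ℕ) × ℕ) → ℤ,
      CodeFP (pairE (pairE natE natE) (pairE (pairE intE (pairE intE (pairE intE natE))) unE)) intE logE ∧
      ∀ (a b : ℕ), 1 ≤ a → 1 ≤ b → ∀ (e : ℤ × ℤ × ℤ × ℕ) (prec : ℕ), 1 ≤ e.2.2.2 →
        (1 : ℝ) / 2 ^ prec ≤ ((((e).1 : ℤ) : ℝ) + (((e).2.1 : ℤ) : ℝ) * (((a * b ^ 2 : ℕ) : ℝ) ^ ((1 : ℝ) / 3)) +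
              (((e).2.2.1 : ℤ) : ℝ) * (((a ^ 2 * b : ℕ) : ℝ) ^ ((1 : ℝ) / 3))) / (((e).2.2.2 : ℕ) : ℝ) →
        |((logE ((a, b), (e, prec)) : ℤ) : ℝ) - 2 ^ prec * Real.log (((((e).1 : ℤ) : ℝ) + (((e).2.1 : ℤ) : ℝ) * (((a * b ^ 2 : ℕ) : ℝ) ^ ((1 : ℝ) / 3)) +
              (((e).2.2.1 : ℤ) : ℝ) * (((a ^ 2 * b : ℕ) : ℝ) ^ ((1 : ℝ) / 3))) / (((e).2.2.2 : ℕ) : ℝ))| ≤ 1 := by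
  refine ⟨_, codeFP_cubicLogCore codeFP_cubicLogExp, ?_⟩
  intro a b _ _ e prec hden hV
  obtain ⟨x, y, z, den⟩ := e
  exact cubicLog_spec hden x y z le_rfl hV

end Summit.QuantumAdvantage.QuantumAdvantage.Theorems.LinnikCubicClassGroups
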